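/-
Copyright (c) 2026 the pub-hodgecm-mathlib formalisation cell (harness21).  Prover seat hodgecm-mathlib-K2E3-p03 (g4), Track B «K2-LIT» ∕ h413
(`stmt-HodgeConjecture-24833`), line `K2_E3_EllipticInputs`, unit U12, road «GL-[M6]-sc» (line lead K2E3-p23 (g5), deal (M5-3)), brick B4-1d, FILE 1 OF 2:
THE TRICHOTOMY OF A SEPARABLE CUBIC CHARACTERISTIC POLYNOMIAL, THE CENTRALISER OF `ḡ` IN `G' = GL₃(F) ⧸ ϖ^ℤ·1` IS THE IMAGE OF THE CENTRALISER OF `g`,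
AND A RATIONAL (SIMPLE) EIGENVALUE MAKES THAT CENTRALISER NON-COMPACT.  2026-09-04.
-/
import Summits.HodgeConjecture.HodgeConjecture.Theorems.K2E3CubicRationalRootsLocallyConstant   -- ★ R′ part 2 + ED.2 J0 (this seat): `exists_conj_diagonal_of_card_roots_eq_three`; brings ★ R′ part 1 `card_roots_ne_two_of_natDegree_eq_three`
import Summits.HodgeConjecture.HodgeConjecture.Theorems.K2E3GL3SimpleEigenvalueLeviForm         -- ★ S″ (this seat): `exists_conj_leviBlock_of_isRoot_of_derivative_ne_zero`, `charpoly_leviBlock`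
import Summits.HodgeConjecture.HodgeConjecture.Theorems.K2E3GL3ModCocompactCentral              -- ★ B0a (K2E3-p23): `normal_map_scalar`, `map_scalar_le_comap_center`, `quotMap_mk`, `continuous_quotMap`; brings ★ GL-P `K2E3GL3ModCentre.exists_bound_of_isCompact_image` and ★ `zpowDiagGL`
import Mathlib.Algebra.Polynomial.SpecificDegree                                                -- `Polynomial.irreducible_iff_roots_eq_zero_of_degree_le_three`
import HarnessLib

/-!
# K2_E3 road (h413), road «GL-[M6]-sc», brick B4-1d (file 1 of 2) — separable-cubic trichotomy, `Z_{G'}(ḡ) = Z_{GL₃}(g)·ϖ^ℤ ∕ ϖ^ℤ`, and non-compactness for a rational eigenvalue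

Cell `pub/hodgecm-mathlib` (D-0151), Track B (21-frontier RULING «PUSH BOTH» 2026-09-03, director req624), seat K2E3-p03 (g4); by-name deal (M5-3) of the
line lead K2E3-p23 (g5), squad bus 2026-09-04T06:18:49Z (decision (M5-2) «Λ₀ := zpowers ϖ»).  `--supports stmt-HodgeConjecture-24833 --as helper`; THEOREMS ONLY
(no definition ∕ instance ∕ notation ∕ named fact ∕ `sorry`); never imports `Cruxes/…/Lines`.  COUNT-NEUTRAL: this is the case split from which the non-elliptic
bricks B4-A2 ∕ B4-E2 of the road start; it closes no socket by itself.

THE RESULTS.  §1 (any field `K`): for `X : Matrix (Fin 3) (Fin 3) K`,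
* **`card_roots_charpoly_eq_zero_or_one_or_three`** — `#roots χ_X ∈ {0, 1, 3}` (a cubic never has exactly two roots counted with multiplicity in `K`, ★ R′
  `card_roots_ne_two_of_natDegree_eq_three`);
* **`irreducible_charpoly_iff_card_roots_eq_zero`** — `χ_X` irreducible iff it has no root in `K` (Mathlib, degree `≤ 3`); the `2 × 2` twin
  `irreducible_charpoly_two_iff_card_roots_eq_zero`;
* **`exists_conj_leviBlock_irreducible_of_card_roots_eq_one`** — if `χ_X` is separable with exactly one root in `K`, then `X = h · M(m) · h⁻¹` with
  `M(m) = !![m 0, m 1, 0; m 2, m 3, 0; 0, 0, m 4]` and the `2 × 2` block `!![m 0, m 1; m 2, m 3]` having IRREDUCIBLE characteristic polynomial (★ S″ normal form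
  at the simple root + `χ_{M(m)} = χ_A · (X − m 4)`); together with ★ J0 `exists_conj_diagonal_of_card_roots_eq_three` (three roots ⇒ `X ~ diag d`, `d` injective)
  this is the TRICHOTOMY «irreducible ∨ linear × irreducible quadratic ∨ three distinct linear factors» of a separable cubic, in normal-form currency.
§2 (any field `F`, `Λ₀ ≤ F^×`, `G_Λ := GL₃(F) ⧸ Λ₀·1`):
* **`centralizer_mk_eq_map_of_forall_pow_three_eq_one`** — if `Λ₀` contains no non-trivial cube root of unity then `Z_{G_Λ}(ḡ) = (Z_{GL₃(F)}(g))·Λ₀ ∕ Λ₀`: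
  a commutator `y g y⁻¹ g⁻¹ = c·1` with `c ∈ Λ₀` has determinant `c³ = 1`, so `c = 1`;
* **`eq_one_of_mem_zpowers_of_pow_three_eq_one`**, **`centralizer_mk_eq_map`**, **`mk_mem_centralizer_mk_iff`** — the case `Λ₀ = ϖ^ℤ` (`v(ϖ) = exp(−1)`, so
  `ϖ^{3n} = 1 ⇒ n = 0`): `mk y ∈ Z_{G'}(mk g) ↔ y g = g y`.  There are NO twisted cosets modulo `ϖ^ℤ`.
§3 (`F` a non-archimedean local field in the `Valued F ℤᵐ⁰` frame of ★ GL-P ∕ ★ B0a — the `Compatible` instance is not even needed; `G' := GL₃(F) ⧸ ϖ^ℤ·1`):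
* **`diagonal_mul_leviBlock_comm`** — `diag(s, s, t)` commutes with every `M(m)`;
* **`not_isCompact_centralizer_mk_of_isRoot`** — if `χ_g` has a SIMPLE root in `F` (in particular: `χ_g` separable with a rational root,
  **`not_isCompact_centralizer_mk_of_isRoot_of_separable`**), then `Z_{G'}(ḡ)` is NOT compact.  Proof: `g = h M(m) h⁻¹` (★ S″); the torus elements
  `y_k := h · diag(1, 1, ϖ^k) · h⁻¹` centralise `g`; if `Z_{G'}(ḡ)` were compact, so would be `h̄⁻¹ · q(Z_{G'}(ḡ)) · h̄ ⊆ Ḡ = GL₃(F) ∕ Z` (★ B0a `continuous_quotMap`),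
  which contains every `diag(1, 1, ϖ^k) mod Z`; ★ GL-P `exists_bound_of_isCompact_image` bounds the scale-invariant products `v(y₀₀) · v((y⁻¹)₂₂) ≤ exp 2N` on it,
  but for `y = diag(1, 1, ϖ^{2N+1})` that product is `exp(2N+1)`.
File 2 (`K2E3GL3ModUniformizerCentralizerCompact`) proves the converse (irreducible `χ_g` ⇒ `Z_{G'}(ḡ)` compact) and assembles the `iff` and its normal-form
restatement.  [HarishChandra1970, Part VII §3 (compactness of `T∕Z` for elliptic tori); Cartier1979, §I.3–I.4; PlatonovRapinchuk1994, §3.3]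
HONEST LABEL: HC_CM is proved only modulo the 7 printed citations (2 remaining named inputs: hLiu418 = stmt-HodgeConjecture-24832, h413 =
stmt-HodgeConjecture-24833) until rung 0 closes; count-neutral helper.

## References
* [HarishChandra1970] Harish-Chandra (notes by G. van Dijk), *Harmonic Analysis on Reductive p-adic Groups*, LNM 162 (1970), Part VII §3.
* [Cartier1979] P. Cartier, *Representations of p-adic groups: a survey*, Corvallis (1979), §I.3–I.4.
* [PlatonovRapinchuk1994] V. Platonov, A. Rapinchuk, *Algebraic Groups and Number Theory* (1994), §3.3.
-/

set_option autoImplicit false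
set_option linter.dupNamespace false   -- `Summit.HodgeConjecture.HodgeConjecture.…` (D-0017 nested layout; lakefile exemption for Summits)

noncomputable section

open Polynomial Topology
open scoped Matrix MatrixGroups WithZero Valued
open Literature.NumberTheory.Automorphic
open Summit.HodgeConjecture.HodgeConjecture.Cruxes.H413.K2E3CharpolyRootsPerturbation
open Summit.HodgeConjecture.HodgeConjecture.Cruxes.H413.K2E3CubicRationalRootsLocallyConstant
open Summit.HodgeConjecture.HodgeConjecture.Cruxes.H413.K2E3GL3SimpleEigenvalueLeviForm
open Summit.HodgeConjecture.HodgeConjecture.Cruxes.H413.K2E3GL3ModCentre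
open Summit.HodgeConjecture.HodgeConjecture.Cruxes.H413.K2E3GL3ModCocompactCentral

namespace Summit.HodgeConjecture.HodgeConjecture.Cruxes.H413.K2E3GL3ModUniformizerCentralizerTrichotomy

/-! ## §1  The trichotomy of a (separable) cubic characteristic polynomial, in normal-form currency -/

section Trichotomy

variable {K : Type*} [Field K]

/-- (T1) **`#roots χ_X ∈ {0, 1, 3}`** for every `3 × 3` matrix `X` (roots in `K`, counted with multiplicity). [folklore] -/
theorem card_roots_charpoly_eq_zero_or_one_or_three (X : Matrix (Fin 3) (Fin 3) K) :
    X.charpoly.roots.card = 0 ∨ X.charpoly.roots.card = 1 ∨ X.charpoly.roots.card = 3 := by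
  have hdeg : X.charpoly.natDegree = 3 := by rw [Matrix.charpoly_natDegree_eq_dim, Fintype.card_fin]
  have hle : X.charpoly.roots.card ≤ 3 := by
    have h := Polynomial.card_roots' X.charpoly
    rwa [hdeg] at h
  have hne : X.charpoly.roots.card ≠ 2 := card_roots_ne_two_of_natDegree_eq_three hdeg
  omega

/-- (T2) **`χ_X` is irreducible iff it has no root in `K`** (`X` a `3 × 3` matrix). [folklore] -/
theorem irreducible_charpoly_iff_card_roots_eq_zero (X : Matrix (Fin 3) (Fin 3) K) :
    Irreducible X.charpoly ↔ X.charpoly.roots.card = 0 := by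
  have hdeg : X.charpoly.natDegree = 3 := by rw [Matrix.charpoly_natDegree_eq_dim, Fintype.card_fin]
  rw [Polynomial.irreducible_iff_roots_eq_zero_of_degree_le_three (by omega) hdeg.le, Multiset.card_eq_zero]

/-- (T2, `2 × 2` twin) `χ_A` is irreducible iff it has no root in `K` (`A` a `2 × 2` matrix). [folklore] -/
theorem irreducible_charpoly_two_iff_card_roots_eq_zero (A : Matrix (Fin 2) (Fin 2) K) :
    Irreducible A.charpoly ↔ A.charpoly.roots.card = 0 := by
  have hdeg : A.charpoly.natDegree = 2 := by rw [Matrix.charpoly_natDegree_eq_dim, Fintype.card_fin]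
  rw [Polynomial.irreducible_iff_roots_eq_zero_of_degree_le_three hdeg.ge (by omega), Multiset.card_eq_zero]

/-- The roots of `χ_{M(m)}` are those of the `2 × 2` block together with `m 4`. [folklore] -/
theorem roots_charpoly_leviBlock (m : Fin 5 → K) :
    (!![m 0, m 1, 0; m 2, m 3, 0; 0, 0, m 4] : Matrix (Fin 3) (Fin 3) K).charpoly.roots =
      (!![m 0, m 1; m 2, m 3] : Matrix (Fin 2) (Fin 2) K).charpoly.roots + {m 4} := by
  rw [charpoly_leviBlock, Polynomial.roots_mul (mul_ne_zero (Matrix.charpoly_monic _).ne_zero (Polynomial.X_sub_C_ne_zero _)),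
    Polynomial.roots_X_sub_C]

/-- A root of a separable polynomial is simple: the derivative does not vanish there. [folklore] -/
theorem derivative_eval_ne_zero_of_separable {f : K[X]} (hsep : f.Separable) {a : K} (ha : f.IsRoot a) : f.derivative.eval a ≠ 0 := by
  have h := hsep.aeval_derivative_ne_zero (x := a) (by rw [Polynomial.coe_aeval_eq_eval]; exact ha)
  rwa [Polynomial.coe_aeval_eq_eval] at h

/-- (T3) **One rational root ⇒ Levi normal form with irreducible `2 × 2` block**: if `χ_X` is separable with exactly one root in `K`, then
`X = h · M(m) · h⁻¹` with `M(m) = !![m 0, m 1, 0; m 2, m 3, 0; 0, 0, m 4]` and `χ_{!![m 0, m 1; m 2, m 3]}` irreducible (★ S″ at the simple root; the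
block has no root since `#roots χ_X = #roots χ_A + 1`). [folklore; cite: PlatonovRapinchuk1994, §3.3] -/
theorem exists_conj_leviBlock_irreducible_of_card_roots_eq_one (X : Matrix (Fin 3) (Fin 3) K) (hsep : X.charpoly.Separable)
    (h1 : X.charpoly.roots.card = 1) :
    ∃ (g : GL (Fin 3) K) (m : Fin 5 → K), Irreducible (!![m 0, m 1; m 2, m 3] : Matrix (Fin 2) (Fin 2) K).charpoly ∧
      X = (g : Matrix (Fin 3) (Fin 3) K) * !![m 0, m 1, 0; m 2, m 3, 0; 0, 0, m 4] * ((g⁻¹ : GL (Fin 3) K) : Matrix (Fin 3) (Fin 3) K) := by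
  obtain ⟨a, ha⟩ := Multiset.card_eq_one.1 h1
  have har : X.charpoly.IsRoot a := by
    have hmem : a ∈ X.charpoly.roots := by rw [ha]; exact Multiset.mem_singleton_self a
    exact (Polynomial.mem_roots (Matrix.charpoly_monic X).ne_zero).1 hmem
  obtain ⟨g, m, -, hX⟩ := exists_conj_leviBlock_of_isRoot_of_derivative_ne_zero X a har (derivative_eval_ne_zero_of_separable hsep har)
  refine ⟨g, m, ?_, hX⟩
  rw [irreducible_charpoly_two_iff_card_roots_eq_zero]
  have hc : X.charpoly = (!![m 0, m 1, 0; m 2, m 3, 0; 0, 0, m 4] : Matrix (Fin 3) (Fin 3) K).charpoly := by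
    rw [hX, Matrix.coe_units_inv, Matrix.charpoly_units_conj]
  have h := h1
  rw [hc, roots_charpoly_leviBlock, Multiset.card_add, Multiset.card_singleton] at h
  omega

/-- (T3, eigenvalue form) a SIMPLE rational root `a` of `χ_X` with `χ_X` having exactly one root gives the Levi normal form with `m 4 = a` and irreducible
block. [folklore] -/
theorem exists_conj_leviBlock_irreducible_of_isRoot (X : Matrix (Fin 3) (Fin 3) K) {a : K} (ha : X.charpoly.IsRoot a)
    (ha' : X.charpoly.derivative.eval a ≠ 0) (h1 : X.charpoly.roots.card = 1) :
    ∃ (g : GL (Fin 3) K) (m : Fin 5 → K), m 4 = a ∧ Irreducible (!![m 0, m 1; m 2, m 3] : Matrix (Fin 2) (Fin 2) K).charpoly ∧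
      X = (g : Matrix (Fin 3) (Fin 3) K) * !![m 0, m 1, 0; m 2, m 3, 0; 0, 0, m 4] * ((g⁻¹ : GL (Fin 3) K) : Matrix (Fin 3) (Fin 3) K) := by
  obtain ⟨g, m, hm4, hX⟩ := exists_conj_leviBlock_of_isRoot_of_derivative_ne_zero X a ha ha'
  refine ⟨g, m, hm4, ?_, hX⟩
  rw [irreducible_charpoly_two_iff_card_roots_eq_zero]
  have hc : X.charpoly = (!![m 0, m 1, 0; m 2, m 3, 0; 0, 0, m 4] : Matrix (Fin 3) (Fin 3) K).charpoly := by
    rw [hX, Matrix.coe_units_inv, Matrix.charpoly_units_conj]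
  have h := h1
  rw [hc, roots_charpoly_leviBlock, Multiset.card_add, Multiset.card_singleton] at h
  omega

/-- In the Levi normal form the `2 × 2` block has irreducible characteristic polynomial iff `χ_X` has exactly one root. [folklore] -/
theorem irreducible_block_iff_card_roots_eq_one (g : GL (Fin 3) K) (m : Fin 5 → K) :
    Irreducible (!![m 0, m 1; m 2, m 3] : Matrix (Fin 2) (Fin 2) K).charpoly ↔
      ((g : Matrix (Fin 3) (Fin 3) K) * !![m 0, m 1, 0; m 2, m 3, 0; 0, 0, m 4] * ((g⁻¹ : GL (Fin 3) K) : Matrix (Fin 3) (Fin 3) K)).charpoly.roots.card = 1 := by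
  rw [irreducible_charpoly_two_iff_card_roots_eq_zero, Matrix.coe_units_inv, Matrix.charpoly_units_conj, roots_charpoly_leviBlock, Multiset.card_add,
    Multiset.card_singleton]
  omega

/-- A conjugate of a diagonal matrix with distinct entries has exactly three roots. [folklore] -/
theorem card_roots_charpoly_conj_diagonal (g : GL (Fin 3) K) {d : Fin 3 → K} :
    ((g : Matrix (Fin 3) (Fin 3) K) * Matrix.diagonal d * ((g⁻¹ : GL (Fin 3) K) : Matrix (Fin 3) (Fin 3) K)).charpoly.roots.card = 3 := by
  rw [Matrix.coe_units_inv, Matrix.charpoly_units_conj, Matrix.charpoly_diagonal, Polynomial.roots_prod _ _ ?_]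
  · rw [Multiset.card_bind]
    simp
  · exact Finset.prod_ne_zero_iff.2 fun i _ => Polynomial.X_sub_C_ne_zero (d i)

/-- `diag(s, s, t)` commutes with every Levi block `M(m)`. [folklore] -/
theorem diagonal_mul_leviBlock_comm (d : Fin 3 → K) (hd : d 0 = d 1) (m : Fin 5 → K) :
    Matrix.diagonal d * !![m 0, m 1, 0; m 2, m 3, 0; 0, 0, m 4] = !![m 0, m 1, 0; m 2, m 3, 0; 0, 0, m 4] * Matrix.diagonal d := by
  ext i j
  rw [Matrix.diagonal_mul, Matrix.mul_diagonal]
  fin_cases i <;> fin_cases j <;> simp [hd, mul_comm]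

end Trichotomy

/-! ## §2  `Z_{G_Λ}(ḡ)` is the image of `Z_{GL₃(F)}(g)` when `Λ₀` has no non-trivial cube roots of unity — in particular for `Λ₀ = ϖ^ℤ` -/

section Key

variable {F : Type*} [Field F]

/-- **`Z_{G_Λ}(ḡ) = Z_{GL₃(F)}(g)·Λ₀ ∕ Λ₀`** whenever `c ∈ Λ₀, c³ = 1 ⇒ c = 1`: if `ȳ` commutes with `ḡ` then `g y = y g (c·1)` with `c ∈ Λ₀`, and determinants give
`c³ = 1`. [cite: PlatonovRapinchuk1994, §3.3] -/
theorem centralizer_mk_eq_map_of_forall_pow_three_eq_one (Λ₀ : Subgroup Fˣ) [(Λ₀.map (Matrix.GeneralLinearGroup.scalar (Fin 3))).Normal]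
    (hΛ : ∀ c ∈ Λ₀, c ^ 3 = 1 → c = 1) (g : GL (Fin 3) F) :
    Subgroup.centralizer {(QuotientGroup.mk g : GL (Fin 3) F ⧸ Λ₀.map (Matrix.GeneralLinearGroup.scalar (Fin 3)))} =
      (Subgroup.centralizer {g}).map (QuotientGroup.mk' (Λ₀.map (Matrix.GeneralLinearGroup.scalar (Fin 3)))) := by
  ext x
  constructor
  · intro hx
    obtain ⟨y, rfl⟩ := QuotientGroup.mk_surjective x
    refine Subgroup.mem_map.2 ⟨y, ?_, rfl⟩
    rw [Subgroup.mem_centralizer_singleton_iff] at hx ⊢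
    have hcomm : (QuotientGroup.mk (y * g) : GL (Fin 3) F ⧸ Λ₀.map (Matrix.GeneralLinearGroup.scalar (Fin 3))) = QuotientGroup.mk (g * y) := by
      rw [QuotientGroup.mk_mul, QuotientGroup.mk_mul]
      exact hx
    rw [QuotientGroup.eq] at hcomm
    obtain ⟨c, hc, hs⟩ := Subgroup.mem_map.1 hcomm
    have hgy : g * y = y * g * Matrix.GeneralLinearGroup.scalar (Fin 3) c := by
      rw [hs, mul_inv_cancel_left]
    -- determinants: `c³ = 1`
    have hc3 : c ^ 3 = 1 := by
      have h := congrArg Matrix.GeneralLinearGroup.det hgy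
      rw [map_mul, map_mul, map_mul, Matrix.GeneralLinearGroup.det_scalar, Fintype.card_fin,
        mul_comm (Matrix.GeneralLinearGroup.det g)] at h
      exact left_eq_mul.1 h
    rw [hΛ c hc hc3, map_one, mul_one] at hgy
    exact hgy.symm
  · intro hx
    obtain ⟨y, hy, rfl⟩ := Subgroup.mem_map.1 hx
    rw [Subgroup.mem_centralizer_singleton_iff] at hy ⊢
    change (QuotientGroup.mk y : GL (Fin 3) F ⧸ Λ₀.map (Matrix.GeneralLinearGroup.scalar (Fin 3))) * QuotientGroup.mk g =
      QuotientGroup.mk g * QuotientGroup.mk y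
    rw [← QuotientGroup.mk_mul, ← QuotientGroup.mk_mul, hy]

/-- Under the same hypothesis: **`mk y ∈ Z_{G_Λ}(mk g) ↔ y g = g y`** (the scalars `Λ₀·1` are central). [cite: PlatonovRapinchuk1994, §3.3] -/
theorem mk_mem_centralizer_mk_iff_of_forall_pow_three_eq_one (Λ₀ : Subgroup Fˣ) [(Λ₀.map (Matrix.GeneralLinearGroup.scalar (Fin 3))).Normal]
    (hΛ : ∀ c ∈ Λ₀, c ^ 3 = 1 → c = 1) (g y : GL (Fin 3) F) :
    (QuotientGroup.mk y : GL (Fin 3) F ⧸ Λ₀.map (Matrix.GeneralLinearGroup.scalar (Fin 3))) ∈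
        Subgroup.centralizer {(QuotientGroup.mk g : GL (Fin 3) F ⧸ Λ₀.map (Matrix.GeneralLinearGroup.scalar (Fin 3)))} ↔ y * g = g * y := by
  rw [centralizer_mk_eq_map_of_forall_pow_three_eq_one Λ₀ hΛ g]
  constructor
  · intro h
    obtain ⟨y', hy', hyy'⟩ := Subgroup.mem_map.1 h
    change (QuotientGroup.mk y' : GL (Fin 3) F ⧸ Λ₀.map (Matrix.GeneralLinearGroup.scalar (Fin 3))) = QuotientGroup.mk y at hyy'
    rw [QuotientGroup.eq] at hyy'
    obtain ⟨c, -, hs⟩ := Subgroup.mem_map.1 hyy'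
    have hy : y = y' * Matrix.GeneralLinearGroup.scalar (Fin 3) c := by rw [hs, mul_inv_cancel_left]
    rw [Subgroup.mem_centralizer_singleton_iff] at hy'
    calc y * g = y' * (g * Matrix.GeneralLinearGroup.scalar (Fin 3) c) := by rw [hy, mul_assoc, Matrix.GeneralLinearGroup.scalar_commute]
      _ = g * y := by rw [← mul_assoc, hy', mul_assoc, ← hy]
  · intro h
    exact Subgroup.mem_map.2 ⟨y, Subgroup.mem_centralizer_singleton_iff.2 h, rfl⟩

variable [Valued F ℤᵐ⁰]

/-- `ϖ^ℤ` contains no non-trivial cube root of unity (`v(ϖ) = exp(−1)`, so `ϖ^{3n} = 1` forces `n = 0`). [folklore] -/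
theorem eq_one_of_mem_zpowers_of_pow_three_eq_one {ϖ : F} (hϖ : Valued.v ϖ = WithZero.exp (-1 : ℤ)) (hϖ0 : ϖ ≠ 0)
    (c : Fˣ) (hc : c ∈ Subgroup.zpowers (Units.mk0 ϖ hϖ0)) (hc3 : c ^ 3 = 1) : c = 1 := by
  obtain ⟨k, rfl⟩ := Subgroup.mem_zpowers_iff.1 hc
  have hv : Valued.v ((((Units.mk0 ϖ hϖ0 ^ k) ^ 3 : Fˣ) : F)) = 1 := by rw [hc3, Units.val_one, map_one]
  rw [Units.val_pow_eq_pow_val, Units.val_zpow_eq_zpow_val, Units.val_mk0, map_pow, map_zpow₀, hϖ, ← WithZero.exp_zsmul, ← WithZero.exp_nsmul,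
    WithZero.exp_eq_one, smul_eq_mul, nsmul_eq_mul] at hv
  have hk : k = 0 := by push_cast at hv; omega
  rw [hk, zpow_zero]

/-- **`Z_{G'}(ḡ) = Z_{GL₃(F)}(g)·ϖ^ℤ ∕ ϖ^ℤ`** for `G' = GL₃(F) ⧸ ϖ^ℤ·1`: there are no twisted cosets modulo `ϖ^ℤ`. [cite: PlatonovRapinchuk1994, §3.3] -/
theorem centralizer_mk_eq_map {ϖ : F} (hϖ : Valued.v ϖ = WithZero.exp (-1 : ℤ)) (hϖ0 : ϖ ≠ 0)
    [((Subgroup.zpowers (Units.mk0 ϖ hϖ0)).map (Matrix.GeneralLinearGroup.scalar (Fin 3))).Normal] (g : GL (Fin 3) F) :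
    Subgroup.centralizer {(QuotientGroup.mk g : GL (Fin 3) F ⧸ (Subgroup.zpowers (Units.mk0 ϖ hϖ0)).map (Matrix.GeneralLinearGroup.scalar (Fin 3)))} =
      (Subgroup.centralizer {g}).map (QuotientGroup.mk' ((Subgroup.zpowers (Units.mk0 ϖ hϖ0)).map (Matrix.GeneralLinearGroup.scalar (Fin 3)))) :=
  centralizer_mk_eq_map_of_forall_pow_three_eq_one _ (fun c hc hc3 => eq_one_of_mem_zpowers_of_pow_three_eq_one hϖ hϖ0 c hc hc3) g

/-- **`mk y ∈ Z_{G'}(mk g) ↔ y g = g y`** for `G' = GL₃(F) ⧸ ϖ^ℤ·1`. [cite: PlatonovRapinchuk1994, §3.3] -/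
theorem mk_mem_centralizer_mk_iff {ϖ : F} (hϖ : Valued.v ϖ = WithZero.exp (-1 : ℤ)) (hϖ0 : ϖ ≠ 0)
    [((Subgroup.zpowers (Units.mk0 ϖ hϖ0)).map (Matrix.GeneralLinearGroup.scalar (Fin 3))).Normal] (g y : GL (Fin 3) F) :
    (QuotientGroup.mk y : GL (Fin 3) F ⧸ (Subgroup.zpowers (Units.mk0 ϖ hϖ0)).map (Matrix.GeneralLinearGroup.scalar (Fin 3))) ∈
        Subgroup.centralizer {(QuotientGroup.mk g : GL (Fin 3) F ⧸ (Subgroup.zpowers (Units.mk0 ϖ hϖ0)).map (Matrix.GeneralLinearGroup.scalar (Fin 3)))} ↔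
      y * g = g * y :=
  mk_mem_centralizer_mk_iff_of_forall_pow_three_eq_one _ (fun c hc hc3 => eq_one_of_mem_zpowers_of_pow_three_eq_one hϖ hϖ0 c hc hc3) g y

end Key

/-! ## §3  A rational (simple) eigenvalue makes `Z_{G'}(ḡ)` non-compact -/

section NotCompact

variable {F : Type*} [Field F] [Valued F ℤᵐ⁰] [ValuativeRel F] [IsNonarchimedeanLocalField F]

/-- **A simple rational eigenvalue makes the centraliser non-compact modulo `ϖ^ℤ`.**  If `χ_g` has a root `a ∈ F` with `χ_g'(a) ≠ 0`, then
`Z_{G'}(ḡ) ⊆ G' = GL₃(F) ⧸ ϖ^ℤ·1` is not compact: it contains the images of `h · diag(1, 1, ϖ^k) · h⁻¹` (`g = h M(m) h⁻¹`, ★ S″), whose images in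
`Ḡ = GL₃(F) ∕ Z` violate the scale-invariant entry bound ★ GL-P `exists_bound_of_isCompact_image` of any compact set.
[cite: HarishChandra1970, Part VII §3; cite: Cartier1979, §I.3] -/
theorem not_isCompact_centralizer_mk_of_isRoot {ϖ : F} (hϖ : Valued.v ϖ = WithZero.exp (-1 : ℤ)) (hϖ0 : ϖ ≠ 0)
    [((Subgroup.zpowers (Units.mk0 ϖ hϖ0)).map (Matrix.GeneralLinearGroup.scalar (Fin 3))).Normal]
    (g : GL (Fin 3) F) {a : F} (ha : (g : Matrix (Fin 3) (Fin 3) F).charpoly.IsRoot a) (ha' : (g : Matrix (Fin 3) (Fin 3) F).charpoly.derivative.eval a ≠ 0) :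
    ¬ IsCompact ((Subgroup.centralizer {(QuotientGroup.mk g : GL (Fin 3) F ⧸ (Subgroup.zpowers (Units.mk0 ϖ hϖ0)).map (Matrix.GeneralLinearGroup.scalar (Fin 3)))} :
      Subgroup (GL (Fin 3) F ⧸ (Subgroup.zpowers (Units.mk0 ϖ hϖ0)).map (Matrix.GeneralLinearGroup.scalar (Fin 3)))) :
        Set (GL (Fin 3) F ⧸ (Subgroup.zpowers (Units.mk0 ϖ hϖ0)).map (Matrix.GeneralLinearGroup.scalar (Fin 3)))) := by
  intro hZ
  have hle := map_scalar_le_comap_center (F := F) (Subgroup.zpowers (Units.mk0 ϖ hϖ0))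
  -- (1) the Levi normal form `g = h M(m) h⁻¹`
  obtain ⟨h, m, -, hX⟩ := exists_conj_leviBlock_of_isRoot_of_derivative_ne_zero (g : Matrix (Fin 3) (Fin 3) F) a ha ha'
  have hM : ((h⁻¹ * g * h : GL (Fin 3) F) : Matrix (Fin 3) (Fin 3) F) = !![m 0, m 1, 0; m 2, m 3, 0; 0, 0, m 4] := by
    rw [Units.val_mul, Units.val_mul, hX, ← mul_assoc, ← mul_assoc, Units.inv_mul, one_mul, mul_assoc, Units.inv_mul, mul_one]
  -- (2) the compact set `h̄⁻¹ · q(Z_{G'}(ḡ)) · h̄ ⊆ Ḡ`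
  set c : GL (Fin 3) F ⧸ Subgroup.center (GL (Fin 3) F) := QuotientGroup.mk h with hc
  set Z : Set (GL (Fin 3) F ⧸ (Subgroup.zpowers (Units.mk0 ϖ hϖ0)).map (Matrix.GeneralLinearGroup.scalar (Fin 3))) :=
    SetLike.coe (Subgroup.centralizer {(QuotientGroup.mk g : GL (Fin 3) F ⧸ (Subgroup.zpowers (Units.mk0 ϖ hϖ0)).map (Matrix.GeneralLinearGroup.scalar (Fin 3)))})
    with hZdef
  have hXc : IsCompact ((fun x => c⁻¹ * x * c) ''
      ((QuotientGroup.map _ (Subgroup.center (GL (Fin 3) F)) (MonoidHom.id (GL (Fin 3) F)) hle) '' Z)) :=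
    (hZ.image (continuous_quotMap _ hle)).image ((continuous_const.mul continuous_id).mul continuous_const)
  obtain ⟨N, hN⟩ := exists_bound_of_isCompact_image hϖ hXc
  -- (3) the torus elements `diag(1, 1, ϖ^k)` lie in it
  have hD : ∀ k : ℤ, (QuotientGroup.mk (zpowDiagGL hϖ0 ![0, 0, k]) : GL (Fin 3) F ⧸ Subgroup.center (GL (Fin 3) F)) ∈
      (fun x => c⁻¹ * x * c) '' ((QuotientGroup.map _ (Subgroup.center (GL (Fin 3) F)) (MonoidHom.id (GL (Fin 3) F)) hle) '' Z) := by
    intro k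
    have hDM : zpowDiagGL hϖ0 ![0, 0, k] * (h⁻¹ * g * h) = h⁻¹ * g * h * zpowDiagGL hϖ0 ![0, 0, k] := by
      apply Units.ext
      rw [Units.val_mul, hM, Units.val_mul, hM, coe_zpowDiagGL]
      exact diagonal_mul_leviBlock_comm _ rfl m
    have hy : h * zpowDiagGL hϖ0 ![0, 0, k] * h⁻¹ * g = g * (h * zpowDiagGL hϖ0 ![0, 0, k] * h⁻¹) := by
      calc h * zpowDiagGL hϖ0 ![0, 0, k] * h⁻¹ * g = h * (zpowDiagGL hϖ0 ![0, 0, k] * (h⁻¹ * g * h)) * h⁻¹ := by group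
        _ = h * (h⁻¹ * g * h * zpowDiagGL hϖ0 ![0, 0, k]) * h⁻¹ := by rw [hDM]
        _ = g * (h * zpowDiagGL hϖ0 ![0, 0, k] * h⁻¹) := by group
    refine ⟨QuotientGroup.map _ (Subgroup.center (GL (Fin 3) F)) (MonoidHom.id (GL (Fin 3) F)) hle (QuotientGroup.mk (h * zpowDiagGL hϖ0 ![0, 0, k] * h⁻¹)),
      ⟨QuotientGroup.mk (h * zpowDiagGL hϖ0 ![0, 0, k] * h⁻¹), ?_, rfl⟩, ?_⟩
    · rw [hZdef]
      exact (mk_mem_centralizer_mk_iff hϖ hϖ0 g _).2 hy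
    · change c⁻¹ * _ * c = _
      rw [quotMap_mk, hc, ← QuotientGroup.mk_inv, ← QuotientGroup.mk_mul, ← QuotientGroup.mk_mul]
      congr 1
      group
  -- (4) the scale-invariant bound fails at `k = 2N + 1`
  have hb := hN (zpowDiagGL hϖ0 ![0, 0, (2 * (N : ℤ) + 1)]) (hD _) 0 0 2 2
  have e0 : (![0, 0, (2 * (N : ℤ) + 1)] : Fin 3 → ℤ) 0 = 0 := rfl
  have e2 : (-(![0, 0, (2 * (N : ℤ) + 1)] : Fin 3 → ℤ)) 2 = -(2 * (N : ℤ) + 1) := rfl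
  rw [← zpowDiagGL_neg, coe_zpowDiagGL, coe_zpowDiagGL, Matrix.diagonal_apply_eq, Matrix.diagonal_apply_eq, e0, e2, zpow_zero, map_one, one_mul,
    map_zpow₀, hϖ, ← WithZero.exp_zsmul, smul_eq_mul, WithZero.exp_le_exp] at hb
  omega

/-- **Separable `χ_g` with a rational root ⇒ `Z_{G'}(ḡ)` is not compact** (the root is simple). [cite: HarishChandra1970, Part VII §3] -/
theorem not_isCompact_centralizer_mk_of_isRoot_of_separable {ϖ : F} (hϖ : Valued.v ϖ = WithZero.exp (-1 : ℤ)) (hϖ0 : ϖ ≠ 0)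
    [((Subgroup.zpowers (Units.mk0 ϖ hϖ0)).map (Matrix.GeneralLinearGroup.scalar (Fin 3))).Normal]
    (g : GL (Fin 3) F) (hsep : (g : Matrix (Fin 3) (Fin 3) F).charpoly.Separable) {a : F} (ha : (g : Matrix (Fin 3) (Fin 3) F).charpoly.IsRoot a) :
    ¬ IsCompact ((Subgroup.centralizer {(QuotientGroup.mk g : GL (Fin 3) F ⧸ (Subgroup.zpowers (Units.mk0 ϖ hϖ0)).map (Matrix.GeneralLinearGroup.scalar (Fin 3)))} :
      Subgroup (GL (Fin 3) F ⧸ (Subgroup.zpowers (Units.mk0 ϖ hϖ0)).map (Matrix.GeneralLinearGroup.scalar (Fin 3)))) :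
        Set (GL (Fin 3) F ⧸ (Subgroup.zpowers (Units.mk0 ϖ hϖ0)).map (Matrix.GeneralLinearGroup.scalar (Fin 3)))) :=
  not_isCompact_centralizer_mk_of_isRoot hϖ hϖ0 g ha (derivative_eval_ne_zero_of_separable hsep ha)

/-- **Not irreducible ⇒ not compact** (separable `χ_g`): a reducible separable cubic has a rational root. [cite: HarishChandra1970, Part VII §3] -/
theorem not_isCompact_centralizer_mk_of_not_irreducible {ϖ : F} (hϖ : Valued.v ϖ = WithZero.exp (-1 : ℤ)) (hϖ0 : ϖ ≠ 0)
    [((Subgroup.zpowers (Units.mk0 ϖ hϖ0)).map (Matrix.GeneralLinearGroup.scalar (Fin 3))).Normal]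
    (g : GL (Fin 3) F) (hsep : (g : Matrix (Fin 3) (Fin 3) F).charpoly.Separable) (hirr : ¬ Irreducible (g : Matrix (Fin 3) (Fin 3) F).charpoly) :
    ¬ IsCompact ((Subgroup.centralizer {(QuotientGroup.mk g : GL (Fin 3) F ⧸ (Subgroup.zpowers (Units.mk0 ϖ hϖ0)).map (Matrix.GeneralLinearGroup.scalar (Fin 3)))} :
      Subgroup (GL (Fin 3) F ⧸ (Subgroup.zpowers (Units.mk0 ϖ hϖ0)).map (Matrix.GeneralLinearGroup.scalar (Fin 3)))) :
        Set (GL (Fin 3) F ⧸ (Subgroup.zpowers (Units.mk0 ϖ hϖ0)).map (Matrix.GeneralLinearGroup.scalar (Fin 3)))) := by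
  rw [irreducible_charpoly_iff_card_roots_eq_zero, Multiset.card_eq_zero] at hirr
  obtain ⟨a, ha⟩ := Multiset.exists_mem_of_ne_zero hirr
  exact not_isCompact_centralizer_mk_of_isRoot_of_separable hϖ hϖ0 g hsep ((Polynomial.mem_roots (Matrix.charpoly_monic _).ne_zero).1 ha)

end NotCompact

end Summit.HodgeConjecture.HodgeConjecture.Cruxes.H413.K2E3GL3ModUniformizerCentralizerTrichotomy
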